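import Summits.CriticalPhenomena.CardyFormulaZ2.Theorems.CardyIKTransportIKLinearTransportStubPinnedExchange

/-!
# Typed CORE TARGETS for the two RSW residues of crux `CardyIKTransport.IKLinearTransport`
# (stmt-CriticalPhenomena-5076) — crux-strategist seat s2, 2026-08-17

Both open RSW stubs of the live line (`stub_lrCrossAll`, `stub_ringAll`, skeleton v26) and the sister crux
stmt-5911 (`HorizontalClause`) reduce — by the leads' memos (5076 c7 `RingsIsoNegative-c7.md` §4 "hook form",
5911 c7 §5.3/§6/§7, 5911 junction-c1 §4) — to ONE within-region junction / boundary-arm estimate for the PURE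
isotropic model `νmix univ`.  This file only TYPES the two cleanest forms of that core over the line vocabulary
(`νmix`, `lrCross`, `tbCross`, `determinedOn`, `farFrom`), so that disprover `-- Targets`, TTRL narrowing and
future lines of the route children can cite them verbatim.  Nothing here is claimed proved; see
`Cruxes/IKLinearTransport/STRATEGY-CENSUS.md` (s2) for status, numerics and why each is believed true.

* `IsoTJunction` / `IsoTJunctionFamily` — T-JUNCTION lower bound: a black left–right crossing of a `w × h` box
  AND a black bottom–top crossing of a box whose column range lies inside it and which sticks out by `m ≥ 1`
  rows above and below.  Planarity of the cell triangulation forces the two crossings to share a cell, so this is the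
  FKG-free form of "two overlapping hard crossings glue"; numerically `P = r_AC · P(LR) P(TB)` with
  `r_AC ≈ 1.34` flat for `n = 16 … 256` (lead c6 EXP2).  In a Harris–FKG model it is the product of two box
  crossing bounds; here it is the residue.
* `IsoNearCondBoxCrossing` — box crossings at every aspect ratio UNIFORMLY IN A CONDITIONING DETERMINED OUTSIDE
  THE BOX (distance 0; the landed `stub_FarRSWOfInputs` gives distance `≍ n`, `CondRSWBound`).  This is the
  hypothesis under which lowest-crossing (exploration) gluing is mechanical; a refutation would kill every
  exploration-based line on both cruxes at once.  Specialising `E := univ` returns the landed all-aspect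
  statement `pureIK_boxCrossing_allAspects` (p146877) — see the `example`.
-/

noncomputable section

namespace Summit.CriticalPhenomena.CardyFormulaZ2.Cruxes.IKLinearTransport.CoreTargets

open scoped Classical MeasureTheory
open MeasureTheory Set
open Summit.CriticalPhenomena.CardyFormulaZ2.Theorems.IKLinearTransport.PinnedDiagramExchange
open Literature.Probability.Percolation Literature.Probability.LatticeModels

/-- [conjecture] CORE TARGET (J_T): T-junction at aspect 2 for the pure isotropic IK model — with probability `≥ c`,
uniformly in `n ≥ 1` and position, the `2n × n` box `[a, a+2n) × [b, b+n)` is crossed left–right by a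
black path AND the `n × (n+2)` box `[a+n, a+2n) × [b-1, b+n+1)` (right half of the columns, ONE row of
slack above and below) is crossed bottom–top by a black path; planarity of the cell triangulation then makes
the two paths share a cell.  Numerically `≈ 0.12` at `n = 16 … 256` (lead c6 EXP2: `r_AC ≈ 1.34`). [folklore] -/
def IsoTJunction : Prop :=
  ∃ c : ℝ, 0 < c ∧ ∀ n : ℕ, 1 ≤ n → ∀ a b : ℤ,
    c ≤ (νmix Set.univ).real (lrCross a b (2 * n) n ∩ tbCross (a + n) (b - 1) n (n + 2))

/-- [conjecture] CORE TARGET (J_T^∀): the all-aspect T-junction family for the pure isotropic model — for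
every aspect bound `k` a constant `c_k > 0` such that for every `w × h` box with `n ≤ w, h ≤ k n`, every
column sub-range `[a', a'+w') ⊆ [a, a+w)` of width `≥ n` and every slack `1 ≤ m ≤ k n`, the box is crossed
left–right AND the straddling box `[a', a'+w') × [b-m, b+h+m)` is crossed bottom–top, with probability
`≥ c_k` (the two crossings share a cell). [folklore] -/
def IsoTJunctionFamily : Prop :=
  ∀ k : ℕ, ∃ c : ℝ, 0 < c ∧ ∀ n : ℕ, 1 ≤ n → ∀ (a b : ℤ) (w h : ℕ),
    n ≤ w → w ≤ k * n → n ≤ h → h ≤ k * n → ∀ (a' : ℤ) (w' m : ℕ), a ≤ a' → a' + w' ≤ a + w → n ≤ w' →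
      1 ≤ m → m ≤ k * n →
        c ≤ (νmix Set.univ).real (lrCross a b w h ∩ tbCross a' (b - m) w' (h + 2 * m))

/-- [conjecture] CORE TARGET (UBC₀): box crossings of the pure isotropic model at every aspect ratio, UNIFORMLY IN ANY
CONDITIONING determined by the cells and faces outside the box (sup-distance `≥ 1`): for every `k` there is
`c_k > 0` with `ν(E ∩ LR) ≥ c_k ν(E)` and `ν(E ∩ TB) ≥ c_k ν(E)` for every measurable `E` determined off the
box.  (RSW uniform in boundary conditions at distance 0; the far version, distance `n`, is landed.) [folklore] -/
def IsoNearCondBoxCrossing : Prop :=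
  ∀ k : ℕ, ∃ c : ℝ, 0 < c ∧ ∀ n : ℕ, 1 ≤ n → ∀ (a b : ℤ) (w h : ℕ),
    n ≤ w → w ≤ k * n → n ≤ h → h ≤ k * n → ∀ E : Set Obs, MeasurableSet E →
      E ∈ determinedOn (farFrom a b w h 1) →
        c * (νmix Set.univ).real E ≤ (νmix Set.univ).real (E ∩ lrCross a b w h) ∧
        c * (νmix Set.univ).real E ≤ (νmix Set.univ).real (E ∩ tbCross a b w h)

/-- Sanity of the typing: the conditional target specialises (`E := univ`) to the unconditional
all-aspect box-crossing statement for the pure isotropic model (landed as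
`FarRSWAllAspects.pureIK_boxCrossing_allAspects`, p146877, in `pLR/pTB` form). [folklore] -/
example (h : IsoNearCondBoxCrossing) :
    ∀ k : ℕ, ∃ c : ℝ, 0 < c ∧ ∀ n : ℕ, 1 ≤ n → ∀ (a b : ℤ) (w h : ℕ),
      n ≤ w → w ≤ k * n → n ≤ h → h ≤ k * n →
        c ≤ (νmix Set.univ).real (lrCross a b w h) ∧ c ≤ (νmix Set.univ).real (tbCross a b w h) := by
  intro k
  obtain ⟨c, hc, hk⟩ := h k
  refine ⟨c, hc, fun n hn a b w h' hw hwk hh hhk => ?_⟩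
  haveI : IsProbabilityMeasure (νmix (Set.univ : Set ℤ)) := isProbabilityMeasure_nuMix _
  have hdet : (Set.univ : Set Obs) ∈ determinedOn (farFrom a b w h' 1) := by
    intro x y _; simp
  have := hk n hn a b w h' hw hwk hh hhk Set.univ MeasurableSet.univ hdet
  simpa [probReal_univ] using this

/-- The T-junction family contains the aspect-2 T-junction (`k = 2`, `w = 2n`, `h = n`, `a' = a + n`,
`w' = n`, `m = 1`). [folklore] -/
theorem isoTJunction_of_family (h : IsoTJunctionFamily) : IsoTJunction := by
  obtain ⟨c, hc, hk⟩ := h 2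
  refine ⟨c, hc, fun n hn a b => ?_⟩
  have := hk n hn a b (2 * n) n (by omega) le_rfl le_rfl (by omega) (a + n) n 1 (by omega)
    (by push_cast; omega) le_rfl le_rfl (by omega)
  simpa using this

end Summit.CriticalPhenomena.CardyFormulaZ2.Cruxes.IKLinearTransport.CoreTargets

end
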